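import Summits.HodgeConjecture.HodgeConjecture.Theorems.Ring2AbelianAllConstantPencils
import Literature.AlgebraicGeometry.HodgeTheory.AlgebraicCyclesDefinedOverQbar
import HarnessLib

/-!
# Ring 2 · sub-cell AbelianAll, André axis (seat ab-andre-1), part V — the André-axis nodes are THEOREMS on
# constant pencils: variational transport (`InvariantCyclesHoldFor`) and the algebraic lift hold on `X × C ⟶ C`

HONEST FRAMING (cell rule, page 1): research route, not a corollary; conditional on HC_CM plus one named
minimal statement. `HC_CM` := `Theses.RankFourFaces.CMAbelianHodge`, `HC_AV` :=
`Theses.PadicSemiregularLift.HodgeAbelianVarieties`; item `Theses.RankFourFaces.CMToAbelian` (stmt-16267) stays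
OPEN. Nothing here is a new conjecture or a Literature fact; no hypothesis is displayed in this file at all.

## What is proved (no hypothesis)
Part IV (`Ring2AbelianAllConstantPencils`) constructed the constant pencils `pr₂ : A × C ⟶ C` as the first
inhabitants of `Motives.IsCompactAbelianPencil` and used them to refute the UNREPAIRED β-nodes outright. This part
records the complementary, positive half: on a constant pencil every DIRECTIONAL / VARIATIONAL node of the sub-cell
is a THEOREM, so constant (isotrivial-by-construction) pencils can never refute (2), (3), (3)_deform, R631, (4),
(4′), (L), (L∀) — a refutation of a live André-axis node needs a pencil whose fibres actually vary.
* §F `map_fiberι_snd_mem_algebraicClasses_iff` — `W|_{(X×C)_t}` is algebraic iff `i_t^* W` is algebraic on `X`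
  (chart of part IV + iso-transport of `algebraicClasses`); `map_fiberι_snd_mem_algebraicClasses_iff_of_joined` —
  for `s, t` joined by a path in `C(ℂ)`, `W|_s` algebraic iff `W|_t` algebraic (the slices `i_s ≃ i_t` are
  homotopic, the tree's `complexBetti_map_sliceAt_eq_of_joined`, Fulton §10.3/§19.3); hence
  **`invariantCyclesHoldFor_snd`: Abdulali's (1.1) / the variational Hodge conjecture HOLDS for `pr₂ : X × C ⟶ C`**
  whenever `C(ℂ)` is path connected — in particular for `C` smooth projective
  (`invariantCyclesHoldFor_snd_of_isSmoothProjective`), for ANY `X` and any `g` (no smoothness, rationality or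
  Hodge-type premise is used: algebraicity of ONE slice moves to every slice by homotopy invariance alone).
* §G the node bodies AT the constant compact abelian pencils of part IV: (2)/(3)/(3)_deform conclude
  `InvariantCyclesHoldFor (snd A.X C) (dim A)` (`invariantCyclesHoldFor_constantPencil`); (4)/(4′) are its
  pointed form (`transport_constantPencil`); (L∀)/(L) — the algebraic LIFT — hold with the explicit lift
  `η := pr₁^*(i_{s₀}^* W)` (`exists_algebraic_lift_constantPencil`: `pr₁^*` preserves algebraic classes into an
  abelian variety, `map_mem_algebraicClasses_of_abelianVariety`; `j_{s₀}^* pr₁^* = (e⁻¹)^*`, part IV).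
NOT claimed: (5∀)/(5) (`B(A × C)`: Kleiman's product stability is in the tree only for an abstract Weil theory,
`Motives.standardConjectureB_tensor`, not for `HodgeTheory.StandardConjectureBStar`), (β∀′)/(β′) on constant
pencils (true via the correspondence `Δ_A × C × C`; needs Künneth/Gysin bookkeeping — RING2-MAP AA1.14), and
anything about non-constant pencils. COUNT ONCE: every node is used BY NAME from parts I–IV / ab-andre-2 / deform.
-/

noncomputable section

set_option linter.dupNamespace false

namespace Summit.HodgeConjecture.HodgeConjecture.Ring2.AbelianAll

open CategoryTheory CategoryTheory.Limits AlgebraicGeometry MonoidalCategory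
open Literature.AlgebraicGeometry Literature.AlgebraicGeometry.Motives
open Literature.AlgebraicGeometry.HodgeTheory
open Literature.AlgebraicGeometry.Milne1999 (IsOfCMType)
open Literature.AlgebraicGeometry.Abdulali1994 (InvariantCyclesHoldFor)
open Summit.HodgeConjecture.HodgeConjecture

/-! ## §F Slices of a constant family: algebraicity on one fibre is algebraicity on every fibre -/

section Slices

variable {X C : SchemeOver ℂ}

/-- `i_t^* W = e^*(j_t^* W)` for a chart `e : X ≅ (X × C)_t` with `e ≫ j_t = i_t`. [cite: Fulton1998, §10.1] -/
theorem complexBetti_map_sliceAt_eq_of_eq {t : ComplexPoints C} {e : X ≅ fiberOver (CartesianMonoidalCategory.snd X C) t}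
    (he : e.hom ≫ fiberι (CartesianMonoidalCategory.snd X C) t = sliceAt X t) (i : ℕ)
    (W : complexBetti (X ⊗ C) i) :
    complexBetti.map (sliceAt X t) i W =
      complexBetti.map e.hom i (complexBetti.map (fiberι (CartesianMonoidalCategory.snd X C) t) i W) := by
  symm
  rw [← CategoryTheory.comp_apply, ← complexBetti.map_comp, he]

/-- **`W|_{(X×C)_t}` is algebraic iff `i_t^* W` is algebraic on `X`** (through a chart `e` with `e ≫ j_t = i_t`;
iso-transport of `algebraicClasses`, `mem_algebraicClasses_map_iff_of_iso`). [cite: Fulton1998, §10.1 and §19.1] -/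
theorem map_fiberι_snd_mem_algebraicClasses_iff_of_eq {t : ComplexPoints C}
    {e : X ≅ fiberOver (CartesianMonoidalCategory.snd X C) t}
    (he : e.hom ≫ fiberι (CartesianMonoidalCategory.snd X C) t = sliceAt X t) {p : ℕ}
    (W : complexBetti (X ⊗ C) (2 * p)) :
    complexBetti.map (fiberι (CartesianMonoidalCategory.snd X C) t) (2 * p) W ∈
        algebraicClasses (fiberOver (CartesianMonoidalCategory.snd X C) t) p ↔
      complexBetti.map (sliceAt X t) (2 * p) W ∈ algebraicClasses X p := by
  rw [complexBetti_map_sliceAt_eq_of_eq he, mem_algebraicClasses_map_iff_of_iso e]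

/-- Chart-free form of `map_fiberι_snd_mem_algebraicClasses_iff_of_eq` (part IV `exists_sliceFiberIso`).
[cite: Fulton1998, §10.1 and §19.1] -/
theorem map_fiberι_snd_mem_algebraicClasses_iff (X : SchemeOver ℂ) (t : ComplexPoints C) {p : ℕ}
    (W : complexBetti (X ⊗ C) (2 * p)) :
    complexBetti.map (fiberι (CartesianMonoidalCategory.snd X C) t) (2 * p) W ∈
        algebraicClasses (fiberOver (CartesianMonoidalCategory.snd X C) t) p ↔
      complexBetti.map (sliceAt X t) (2 * p) W ∈ algebraicClasses X p := by
  obtain ⟨e, he⟩ := exists_sliceFiberIso X t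
  exact map_fiberι_snd_mem_algebraicClasses_iff_of_eq he W

/-- **Algebraicity moves between the fibres of a constant family over points joined by a path**: the slices
`i_s, i_t : X(ℂ) → (X × C)(ℂ)` are homotopic, so `i_s^* = i_t^*` (`complexBetti_map_sliceAt_eq_of_joined`,
Hatcher §3.1), and `W|_s`, `W|_t` are the images of the same class of `X` under the charts.
[cite: Fulton1998, §10.3 and §19.3] [cite: HatcherAT2002, §3.1 p. 201] -/
theorem map_fiberι_snd_mem_algebraicClasses_iff_of_joined (X : SchemeOver ℂ) {s t : ComplexPoints C}
    (h : Joined s t) {p : ℕ} (W : complexBetti (X ⊗ C) (2 * p)) :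
    complexBetti.map (fiberι (CartesianMonoidalCategory.snd X C) s) (2 * p) W ∈
        algebraicClasses (fiberOver (CartesianMonoidalCategory.snd X C) s) p ↔
      complexBetti.map (fiberι (CartesianMonoidalCategory.snd X C) t) (2 * p) W ∈
        algebraicClasses (fiberOver (CartesianMonoidalCategory.snd X C) t) p := by
  rw [map_fiberι_snd_mem_algebraicClasses_iff X s W, map_fiberι_snd_mem_algebraicClasses_iff X t W,
    complexBetti_map_sliceAt_eq_of_joined h]

/-- The same over a base with path-connected complex points. [cite: Fulton1998, §10.3 and §19.3] -/
theorem map_fiberι_snd_mem_algebraicClasses_iff_of_pathConnectedSpace (X : SchemeOver ℂ)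
    [PathConnectedSpace (ComplexPoints C)] (s t : ComplexPoints C) {p : ℕ} (W : complexBetti (X ⊗ C) (2 * p)) :
    complexBetti.map (fiberι (CartesianMonoidalCategory.snd X C) s) (2 * p) W ∈
        algebraicClasses (fiberOver (CartesianMonoidalCategory.snd X C) s) p ↔
      complexBetti.map (fiberι (CartesianMonoidalCategory.snd X C) t) (2 * p) W ∈
        algebraicClasses (fiberOver (CartesianMonoidalCategory.snd X C) t) p :=
  map_fiberι_snd_mem_algebraicClasses_iff_of_joined X (PathConnectedSpace.joined s t) W

/-- **The variational Hodge conjecture / Abdulali's Conjecture (1.1) HOLDS for every constant family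
`pr₂ : X × C ⟶ C` over a base with path-connected complex points** — for any `X` and any `g`: a global class
algebraic on one fibre is algebraic on every fibre (the rationality and Hodge-type premises are not even used).
[cite: Abdulali1994FamiliesAV, (1.1) (p. 1122)] [cite: Fulton1998, §10.3 and §19.3] -/
theorem invariantCyclesHoldFor_snd (X : SchemeOver ℂ) [PathConnectedSpace (ComplexPoints C)] (g : ℕ) :
    InvariantCyclesHoldFor (CartesianMonoidalCategory.snd X C) g := by
  rintro p W - ⟨s₀, h₀⟩ s
  exact (map_fiberι_snd_mem_algebraicClasses_iff_of_pathConnectedSpace X s s₀ W).2 h₀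

/-- `InvariantCyclesHoldFor (pr₂ : X × C ⟶ C) g` for `C` smooth projective (then `C(ℂ)` is path connected:
SGA1 XII 2.4 + manifold charts, the tree's `pathConnectedSpace_complexPoints_of_isSmoothProjective'`).
[cite: Abdulali1994FamiliesAV, (1.1) (p. 1122)] [cite: SGA1, Exp. XII Prop. 2.4] -/
theorem invariantCyclesHoldFor_snd_of_isSmoothProjective (X : SchemeOver ℂ) {n : ℕ} (hC : IsSmoothProjective n C)
    (g : ℕ) : InvariantCyclesHoldFor (CartesianMonoidalCategory.snd X C) g := by
  haveI := pathConnectedSpace_complexPoints_of_isSmoothProjective' hC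
  exact invariantCyclesHoldFor_snd X g

end Slices

/-! ## §G The sub-cell's directional nodes, instantiated at the constant compact abelian pencils of part IV -/

section Nodes

variable (A : AbelianVariety ℂ) {C : SchemeOver ℂ}

/-- **(2) `Deform.CompactAbelianPencilVHC`, (3) `CMPointedPencilVHC`, (3)_deform `Deform.CMPointedCompactPencilVHC`
and R631 `Deform.CMAnchoredPencilVHC` all conclude `InvariantCyclesHoldFor f _`; at the constant compact abelian
pencil `pr₂ : A × C ⟶ C` (part IV `isCompactAbelianPencil_snd`) that conclusion is a THEOREM.**
[cite: Abdulali1994FamiliesAV, (1.1) (p. 1122)] [cite: Andre1996Motifs, §6.3 footnote (2) (p. 31)] -/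
theorem invariantCyclesHoldFor_constantPencil (hC : IsSmoothProjective 1 C) :
    IsCompactAbelianPencil (CartesianMonoidalCategory.snd A.X C) A.dim ∧
      InvariantCyclesHoldFor (CartesianMonoidalCategory.snd A.X C) A.dim :=
  ⟨isCompactAbelianPencil_snd A hC, invariantCyclesHoldFor_snd_of_isSmoothProjective A.X hC A.dim⟩

/-- **(4) `CMFibreTransport` / (4′) `CMAnchoredTransport` at a constant pencil**: algebraicity of `W` on the fibre
over `t` gives it on every fibre — with no CM, rationality or Hodge-type premise. [cite: Fulton1998, §10.3 and §19.3] -/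
theorem transport_constantPencil {n : ℕ} (hC : IsSmoothProjective n C) {p : ℕ} (W : complexBetti (A.X ⊗ C) (2 * p))
    (t : ComplexPoints C)
    (ht : complexBetti.map (fiberι (CartesianMonoidalCategory.snd A.X C) t) (2 * p) W ∈
      algebraicClasses (fiberOver (CartesianMonoidalCategory.snd A.X C) t) p)
    (s : ComplexPoints C) :
    complexBetti.map (fiberι (CartesianMonoidalCategory.snd A.X C) s) (2 * p) W ∈
      algebraicClasses (fiberOver (CartesianMonoidalCategory.snd A.X C) s) p := by
  haveI := pathConnectedSpace_complexPoints_of_isSmoothProjective' hC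
  exact (map_fiberι_snd_mem_algebraicClasses_iff_of_pathConnectedSpace A.X s t W).2 ht

/-- **(L∀) `AlgebraicFixedPart` / (L) `CMFibreAlgebraicLift` at a constant pencil**: if `W|_{s₀}` is algebraic then
`η := pr₁^*(i_{s₀}^* W)` is an ALGEBRAIC class of the total space `A × C` with `η|_{s₀} = W|_{s₀}` (pull-back into
an abelian variety preserves algebraic classes, `map_mem_algebraicClasses_of_abelianVariety`; `j_{s₀}^* pr₁^* =
(e⁻¹)^*` for the chart `e`, part IV). [cite: Andre1996Motifs, §5.1 (p. 25)] [cite: Fulton1998, §10.1 and §19.1] -/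
theorem exists_algebraic_lift_constantPencil {n : ℕ} (hC : IsSmoothProjective n C) {p : ℕ}
    (W : complexBetti (A.X ⊗ C) (2 * p)) (s₀ : ComplexPoints C)
    (h₀ : complexBetti.map (fiberι (CartesianMonoidalCategory.snd A.X C) s₀) (2 * p) W ∈
      algebraicClasses (fiberOver (CartesianMonoidalCategory.snd A.X C) s₀) p) :
    ∃ η ∈ algebraicClasses (A.X ⊗ C) p,
      complexBetti.map (fiberι (CartesianMonoidalCategory.snd A.X C) s₀) (2 * p) η =
        complexBetti.map (fiberι (CartesianMonoidalCategory.snd A.X C) s₀) (2 * p) W := by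
  have hA : IsSmoothProjective A.dim A.X := AbelianVariety.isSmoothProjective_holds
  obtain ⟨e, he⟩ := exists_sliceFiberIso A.X s₀
  have halg : complexBetti.map (sliceAt A.X s₀) (2 * p) W ∈ algebraicClasses A.X p :=
    (map_fiberι_snd_mem_algebraicClasses_iff_of_eq he W).1 h₀
  refine ⟨complexBetti.map (CartesianMonoidalCategory.fst A.X C) (2 * p)
      (complexBetti.map (sliceAt A.X s₀) (2 * p) W),
    map_mem_algebraicClasses_of_abelianVariety (IsSmoothProjective.tensor_holds hA hC) A _ halg, ?_⟩
  rw [complexBetti_map_fiberι_map_fst_of_eq he, complexBetti_map_sliceAt_eq_of_eq he,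
    ← CategoryTheory.comp_apply, ← complexBetti.map_comp, e.inv_hom_id, complexBetti.map_id]
  rfl

/-- The (L∀)-shaped conclusion with the node's exact premises, at a constant compact abelian pencil over a smooth
projective curve (premises unused). [cite: Andre1996Motifs, §5.1 (p. 25)] -/
theorem algebraicFixedPart_constantPencil (hC : IsSmoothProjective 1 C) (p : ℕ) (W : complexBetti (A.X ⊗ C) (2 * p))
    (_hW : ∀ s : ComplexPoints C,
      IsRationalClass (complexBetti.map (fiberι (CartesianMonoidalCategory.snd A.X C) s) (2 * p) W) ∧
        IsOfHodgeType A.dim (fiberOver (CartesianMonoidalCategory.snd A.X C) s) (2 * p) p p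
          (complexBetti.map (fiberι (CartesianMonoidalCategory.snd A.X C) s) (2 * p) W))
    (s₀ : ComplexPoints C)
    (h₀ : complexBetti.map (fiberι (CartesianMonoidalCategory.snd A.X C) s₀) (2 * p) W ∈
      algebraicClasses (fiberOver (CartesianMonoidalCategory.snd A.X C) s₀) p) :
    ∃ η ∈ algebraicClasses (A.X ⊗ C) p,
      complexBetti.map (fiberι (CartesianMonoidalCategory.snd A.X C) s₀) (2 * p) η =
        complexBetti.map (fiberι (CartesianMonoidalCategory.snd A.X C) s₀) (2 * p) W :=
  exists_algebraic_lift_constantPencil A hC W s₀ h₀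

/-- **Summary row**: at every constant compact abelian pencil over a smooth projective curve, transport
(`InvariantCyclesHoldFor`) AND the algebraic lift hold unconditionally — the live André-axis nodes cannot be
refuted by constant pencils. [cite: Abdulali1994FamiliesAV, (1.1) (p. 1122)] [cite: Andre1996Motifs, §5.1 and §6.3] -/
theorem andreAxis_constantPencil (hC : IsSmoothProjective 1 C) :
    IsCompactAbelianPencil (CartesianMonoidalCategory.snd A.X C) A.dim ∧
      InvariantCyclesHoldFor (CartesianMonoidalCategory.snd A.X C) A.dim ∧
      ∀ (p : ℕ) (W : complexBetti (A.X ⊗ C) (2 * p)) (s₀ : ComplexPoints C),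
        complexBetti.map (fiberι (CartesianMonoidalCategory.snd A.X C) s₀) (2 * p) W ∈
            algebraicClasses (fiberOver (CartesianMonoidalCategory.snd A.X C) s₀) p →
          ∃ η ∈ algebraicClasses (A.X ⊗ C) p,
            complexBetti.map (fiberι (CartesianMonoidalCategory.snd A.X C) s₀) (2 * p) η =
              complexBetti.map (fiberι (CartesianMonoidalCategory.snd A.X C) s₀) (2 * p) W :=
  ⟨isCompactAbelianPencil_snd A hC, invariantCyclesHoldFor_snd_of_isSmoothProjective A.X hC A.dim,
    fun _ W s₀ h₀ ↦ exists_algebraic_lift_constantPencil A hC W s₀ h₀⟩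

end Nodes

end Summit.HodgeConjecture.HodgeConjecture.Ring2.AbelianAll
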